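import Summits.BirchSwinnertonDyer.BirchSwinnertonDyer.Theorems.AdditiveKolyvaginRoadLevelSystems
import Summits.BirchSwinnertonDyer.BirchSwinnertonDyer.Theorems.KolyvaginRoadThreeMethod2EvenLevels
import HarnessLib

/-!
# Route `AdditiveKolyvaginRoad`, crux `LevelKolyvaginSystemsAdditive` (item stmt-BirchSwinnertonDyer-21396, KS′):
# a `LevelKolyvaginSystemP` owes classes ONLY AT EVEN LEVELS, and its `transport` is the composite of the two
# Bertolini–Darmon reciprocity laws through ODD-level values
# (cell `pub/bsd-wall`, width seat `bsd-wall-akr-p2x-w2` g0 on line `birth`; `--supports stmt-BirchSwinnertonDyer-21396`, helper;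
# part 1 of the BIPARTITE DICTIONARY, part 2 = `AdditiveKolyvaginRoadLevelSystemsOfBipartite`)

WHY. The carrier `LevelKolyvaginSystemP W K p Dt β ι c` (`AdditiveKolyvaginRoadLevelSystems`) asks its local axioms at ALL
non-empty levels `n` (finite sets of Bertolini–Darmon admissible primes) and two FORCING fields (lead akr-p2x g0,
CARRIER-AUDIT): `transport` (W. Zhang 2014 Thm. 4.3 in contrapositive form) and `baseCase` (Thm. 7.2 at non-empty EVEN levels
of canonical rank one). In print the structure is BIPARTITE (Bertolini–Darmon 2005 §4; Howard's bipartite Euler systems;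
W. Zhang §§3–4): cohomology classes `κ(m, n)` live at the EVEN levels (indefinite quaternion algebra, Shimura curve
`X_{N,∏n}`), VALUES `λ(m, n) ∈ k` at the ODD levels (definite algebra, Gross points ∕ special values), tied by two laws —
(A) the FINITE part at a NEW admissible prime `q ∉ n` of an even-level class is the value one level up,
`loc_q κ(m, n) ≠ 0 ⟺ λ(m, n∪q) ≠ 0` (BD05 Thm. 4.2 ∕ Zhang (4.8)); (B) the TORIC (singular) part at a LEVEL prime of an
even-level class is the value one level down, `∂_q κ(m, n'∪q) ≠ 0 ⟺ λ(m, n') ≠ 0` (BD05 Thm. 4.1). This file (part 1):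

* §1 `nonempty_levelKolyvaginSystemP_of_evenLevels` — a constructor owes classes ONLY AT EVEN levels:
  `κ m n := if Even #n then κ₀ m n else 0` (p-generic port of koly g16's `Method2EvenLevels` at `p = 3`: at odd levels every
  axiom holds for `0`; two NEW primes keep the parity, so `transport` from an odd bottom level is vacuous).
* §2 `transport_of_reciprocityLaws` — the field `transport` from the ONE-DIRECTIONAL halves actually used: (A⇐)
  `λ(m, n∪q) ≠ 0 ⟹ κ₀(m, n)` not locally trivial above `q`; (B⇒) `κ₀(m, n'∪q)` not locally trivial above `q ⟹ λ(m, n') ≠ 0`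
  (three levels `n ⊂ n∪q₁ ⊂ n∪q₁∪q₂`: (B⇒) then (A⇐) — W. Zhang's proof of Thm. 4.3).
Part 2 derives `baseCase` from the rank-0 ANCHOR at odd levels and assembles the dictionary.

HONEST FRAMING: theorems only; 0 definitions, 0 named facts, 0 `sorry`; every bipartite input is an explicit HYPOTHESIS
(binder); closes nothing. BSD is not proved by any of this.

References: [cite: WZhang2014, §3.1, §3.9 (3.30), Thm. 4.3, (4.8), Def. 8.3, §8.1, §9] [cite: BertoliniDarmon2005, Thm. 4.1,
Thm. 4.2, §2.2–§2.3].
-/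

-- single-conjunct summit: `Summit.BirchSwinnertonDyer.BirchSwinnertonDyer.…` repeats the name by design
set_option linter.dupNamespace false

noncomputable section

open scoped Classical

namespace Summit.BirchSwinnertonDyer.BirchSwinnertonDyer.Theorems.AdditiveKoly

open WeierstrassCurve NumberField IsDedekindDomain
  Literature.NumberTheory.EllipticCurves Literature.NumberTheory.EllipticCurves.ModularForms
  Literature.NumberTheory.EllipticCurves.Rank1Residual Literature.NumberTheory.GaloisRepresentations Module
  Summit.BirchSwinnertonDyer.Rank1Residual.X11b.Three.Koly

variable (W : WeierstrassCurve ℚ) (K : Type) [Field K] [NumberField K] (p : ℕ) [W.IsGloballyMinimal]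
  (c : K ≃ₐ[ℚ] K) [Module (ZMod p) (Vp W K p)]

/-! ## §0 Bookkeeping -/

omit [Module (ZMod p) (Vp W K p)] in
/-- The base locus at a level depends only on the classes AT that level. [cite: WZhang2014, Def. 8.3] -/
theorem baseLocusQP_congr {M : Type} {κ κ' : M → Finset (AdmQ W K p) → Vp W K p} {n : Finset (AdmQ W K p)}
    (h : ∀ m, κ m n = κ' m n) : baseLocusQP W K p κ n = baseLocusQP W K p κ' n := by
  ext q
  simp only [baseLocusQP, Set.mem_setOf_eq, h]

omit [Module (ZMod p) (Vp W K p)] in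
/-- **Off the base locus = some class is detected**: `q ∉ baseLocus(κ, n)` iff some class `κ m n` is NOT locally
trivial at some place above `q`. [cite: WZhang2014, Def. 8.3] -/
theorem not_mem_baseLocusQP_iff {M : Type} {κ : M → Finset (AdmQ W K p) → Vp W K p} {n : Finset (AdmQ W K p)}
    {q : AdmQ W K p} : q ∉ baseLocusQP W K p κ n ↔ ∃ m, ∃ v : HeightOneSpectrum (𝓞 K), ((q : ℕ) : 𝓞 K) ∈ v.asIdeal ∧
      κ m n ∉ (W.baseChange K).torsionLocalKer (v.adicCompletion K) ((p ^ 1 : ℕ) : ℤ) := by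
  simp only [baseLocusQP, Set.mem_setOf_eq, not_forall, exists_prop]

omit [W.IsGloballyMinimal] [Module (ZMod p) (Vp W K p)] in
/-- A class NOT locally trivial at some place is non-zero. [folklore] -/
theorem ne_zero_of_not_mem_torsionLocalKer {x : Vp W K p} {v : HeightOneSpectrum (𝓞 K)}
    (h : x ∉ (W.baseChange K).torsionLocalKer (v.adicCompletion K) ((p ^ 1 : ℕ) : ℤ)) : x ≠ 0 := by
  rintro rfl
  exact h (zero_mem _)

/-- Inserting ONE new prime flips the parity of a level. [folklore] -/
theorem odd_card_insert_iff {α : Type*} [DecidableEq α] {n : Finset α} {q : α} (h : q ∉ n) :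
    Odd (insert q n).card ↔ Even n.card := by
  rw [Finset.card_insert_of_notMem h, Nat.odd_add_one, Nat.not_odd_iff_even]

/-! ## §1 A level system owes classes only at EVEN levels -/

section EvenLevels

variable [W.IsElliptic] [NeZero (W.conductorNorm ℤ)] [Fact p.Prime]
  (Dt : ModularParametrizationData W (W.conductorNorm ℤ)) (β : ℤ) (ι : K →+* ℂ)

omit [W.IsElliptic] in
/-- **A `LevelKolyvaginSystemP` from EVEN-level data** (p-generic port of koly g16's `Method2EvenLevels`). Given classes
`κ₀ m n ∈ H¹(K, E[p])`, signs `ε₀ n`, the `realisation` identity at level `∅`, the axioms `sign` ∕ `selmer_off` ∕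
`selmer_inf` ∕ `toric_on` ∕ `transverse_on` ∕ `relation` ∕ `baseCase` at EVEN non-empty levels and `transport` from EVEN
bottom levels (each the structure's field text with the extra guard `Even n.card →`), the classes
`κ m n := if Even n.card then κ₀ m n else 0` form a `LevelKolyvaginSystemP W K p Dt β ι c`: at odd levels every axiom
holds for the zero class, and `transport`'s hypothesis `q₂ ∉ baseLocus` fails when all classes two levels up vanish (two
NEW primes keep the parity). This is W. Zhang's own bookkeeping: classes on the Shimura CURVES `X_{N,∏n}`, `#n` even; the
odd levels carry definite Shimura sets and no classes. [cite: WZhang2014, §3.1, §3.9 (3.30), §8.1, §9] -/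
theorem nonempty_levelKolyvaginSystemP_of_evenLevels
    (ε₀ : Finset (AdmQ W K p) → Bool)
    (κ₀ : Finset {ℓ // Zhang2014.IsKolyvaginPrime (W.conductorNorm ℤ) W K p ℓ} → Finset (AdmQ W K p) → Vp W K p)
    (realisation : ∀ m : Finset {ℓ // Zhang2014.IsKolyvaginPrime (W.conductorNorm ℤ) W K p ℓ},
      ∃ d : KolyvaginHeegnerData Dt β ι (∏ ℓ ∈ m, (ℓ : ℕ)), κ₀ m ∅ = d.kolyvaginClass (Fact.out : p.Prime) 1)
    (sign : ∀ n : Finset (AdmQ W K p), n.Nonempty → Even n.card →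
      ∀ m : Finset {ℓ // Zhang2014.IsKolyvaginPrime (W.conductorNorm ℤ) W K p ℓ},
      conjAct W c ((p ^ 1 : ℕ) : ℤ) (κ₀ m n) = sgnP (ε₀ n ^^ Nat.bodd m.card) • κ₀ m n)
    (selmer_off : ∀ n : Finset (AdmQ W K p), n.Nonempty → Even n.card →
      ∀ (m : Finset {ℓ // Zhang2014.IsKolyvaginPrime (W.conductorNorm ℤ) W K p ℓ}) (v : HeightOneSpectrum (𝓞 K)),
      (∀ ℓ ∈ m, ((ℓ : ℕ) : 𝓞 K) ∉ v.asIdeal) → (∀ q ∈ n, ((q : ℕ) : 𝓞 K) ∉ v.asIdeal) →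
      κ₀ m n ∈ selmerLocalKer (W.baseChange K) (v.adicCompletion K) ((p ^ 1 : ℕ) : ℤ))
    (selmer_inf : ∀ n : Finset (AdmQ W K p), n.Nonempty → Even n.card →
      ∀ (m : Finset {ℓ // Zhang2014.IsKolyvaginPrime (W.conductorNorm ℤ) W K p ℓ}) (w : InfinitePlace K),
      κ₀ m n ∈ selmerLocalKer (W.baseChange K) w.Completion ((p ^ 1 : ℕ) : ℤ))
    (toric_on : ∀ n : Finset (AdmQ W K p), n.Nonempty → Even n.card →
      ∀ m : Finset {ℓ // Zhang2014.IsKolyvaginPrime (W.conductorNorm ℤ) W K p ℓ}, ∀ q ∈ n,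
      ∀ v : HeightOneSpectrum (𝓞 K), ((q : ℕ) : 𝓞 K) ∈ v.asIdeal →
      κ₀ m n ∈ toricLocalKer (W.baseChange K) (v.adicCompletion K) ((p ^ 1 : ℕ) : ℤ))
    (transverse_on : ∀ n : Finset (AdmQ W K p), n.Nonempty → Even n.card →
      ∀ m : Finset {ℓ // Zhang2014.IsKolyvaginPrime (W.conductorNorm ℤ) W K p ℓ}, ∀ ℓ ∈ m,
      ∀ v : HeightOneSpectrum (𝓞 K), ((ℓ : ℕ) : 𝓞 K) ∈ v.asIdeal → κ₀ m n ∈ transverseLocalKerP W K p ι ℓ v)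
    (relation : ∀ n : Finset (AdmQ W K p), n.Nonempty → Even n.card →
      ∀ (m : Finset {ℓ // Zhang2014.IsKolyvaginPrime (W.conductorNorm ℤ) W K p ℓ})
        (ℓ : {ℓ // Zhang2014.IsKolyvaginPrime (W.conductorNorm ℤ) W K p ℓ}), ℓ ∉ m → ∀ v : HeightOneSpectrum (𝓞 K),
      ((ℓ : ℕ) : 𝓞 K) ∈ v.asIdeal →
      (κ₀ (insert ℓ m) n ∈ (W.baseChange K).torsionLocalKer (v.adicCompletion K) ((p ^ 1 : ℕ) : ℤ) ↔
        κ₀ m n ∈ (W.baseChange K).torsionLocalKer (v.adicCompletion K) ((p ^ 1 : ℕ) : ℤ)))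
    (transport : ∀ (n : Finset (AdmQ W K p)) (q₁ q₂ : AdmQ W K p), q₁ ∉ n → q₂ ∉ insert q₁ n → Even n.card →
      q₂ ∉ baseLocusQP W K p κ₀ (insert q₂ (insert q₁ n)) → ∃ m, κ₀ m n ≠ 0)
    (baseCase : ∀ n : Finset (AdmQ W K p), n.Nonempty → Even n.card →
      finrank (ZMod p) (SelQP W K p c n true) + finrank (ZMod p) (SelQP W K p c n false) = 1 → κ₀ ∅ n ≠ 0) :
    Nonempty (LevelKolyvaginSystemP W K p Dt β ι c) := by
  -- the classes: `κ₀` at even levels, `0` at odd (definite) levels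
  let κ : Finset {ℓ // Zhang2014.IsKolyvaginPrime (W.conductorNorm ℤ) W K p ℓ} → Finset (AdmQ W K p) → Vp W K p :=
    fun m n ↦ if Even n.card then κ₀ m n else 0
  have hκ_even : ∀ {n : Finset (AdmQ W K p)} (_ : Even n.card) (m), κ m n = κ₀ m n := fun hn m ↦ if_pos hn
  have hκ_odd : ∀ {n : Finset (AdmQ W K p)} (_ : ¬ Even n.card) (m), κ m n = 0 := fun hn m ↦ if_neg hn
  refine ⟨⟨ε₀, κ, ?_, ?_, ?_, ?_, ?_, ?_, ?_, ?_, ?_⟩⟩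
  · -- realisation at `∅` (even)
    intro m
    rw [hκ_even (by simp) m]
    exact realisation m
  · -- sign
    intro n hn m
    by_cases he : Even n.card
    · rw [hκ_even he]; exact sign n hn he m
    · rw [hκ_odd he, map_zero, zsmul_zero]
  · -- selmer_off
    intro n hn m v hm hq
    by_cases he : Even n.card
    · rw [hκ_even he]; exact selmer_off n hn he m v hm hq
    · rw [hκ_odd he]; exact zero_mem _
  · -- selmer_inf
    intro n hn m w
    by_cases he : Even n.card
    · rw [hκ_even he]; exact selmer_inf n hn he m w
    · rw [hκ_odd he]; exact zero_mem _
  · -- toric_on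
    intro n hn m q hq v hv
    by_cases he : Even n.card
    · rw [hκ_even he]; exact toric_on n hn he m q hq v hv
    · rw [hκ_odd he]; exact zero_mem _
  · -- transverse_on
    intro n hn m ℓ hℓ v hv
    by_cases he : Even n.card
    · rw [hκ_even he]; exact transverse_on n hn he m ℓ hℓ v hv
    · rw [hκ_odd he]; exact zero_mem _
  · -- relation (8.1)
    intro n hn m ℓ hℓ v hv
    by_cases he : Even n.card
    · rw [hκ_even he, hκ_even he]; exact relation n hn he m ℓ hℓ v hv
    · rw [hκ_odd he, hκ_odd he]
  · -- transport (A2): two NEW primes keep the parity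
    intro n q₁ q₂ hq₁ hq₂ hbase
    have hpar := Method2EvenLevels.even_card_insert_insert_iff (n := n) hq₁ hq₂
    by_cases he : Even n.card
    · have he₂ : Even (insert q₂ (insert q₁ n)).card := hpar.mpr he
      rw [baseLocusQP_congr W K p (fun m ↦ hκ_even he₂ m)] at hbase
      obtain ⟨m, hm⟩ := transport n q₁ q₂ hq₁ hq₂ he hbase
      exact ⟨m, by rwa [hκ_even he]⟩
    · -- odd bottom level: the top level is odd too, all classes there vanish, so `q₂` IS a base point
      have ho₂ : ¬ Even (insert q₂ (insert q₁ n)).card := fun h ↦ he (hpar.mp h)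
      exact absurd (fun m v _ ↦ by rw [hκ_odd ho₂ m]; exact zero_mem _) hbase
  · -- base case (A5) at even levels
    intro n hn he h1
    rw [hκ_even he]
    exact baseCase n hn he h1

end EvenLevels

/-! ## §2 Transport from the two reciprocity laws -/

omit [Module (ZMod p) (Vp W K p)] in
/-- **`transport` FROM THE RECIPROCITY LAWS** (W. Zhang's proof of Thm. 4.3). Let `κ₀(m, n) ∈ H¹(K, E[p])` be classes at
the (even) levels and `λ(m, n) ∈ 𝔽_p` values at the (odd) levels, subject to the two ONE-DIRECTIONAL laws: (A⇐) for `n` even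
and `q ∉ n`, `λ(m, n∪q) ≠ 0 ⟹ κ₀(m, n)` is NOT locally trivial at some place above `q` (finite part at a NEW admissible prime,
BD05 Thm. 4.2 ∕ Zhang (4.8)); (B⇒) for `n'` odd and `q ∉ n'`, `κ₀(m, n'∪q)` NOT locally trivial above `q ⟹ λ(m, n') ≠ 0`
(toric part at a LEVEL prime, BD05 Thm. 4.1). Then for `n` even, `q₁ ∉ n`, `q₂ ∉ n∪q₁`: if `q₂` is off the base locus of
level `n∪q₁∪q₂`, some class `κ₀(m, n)` is non-zero — indeed detected above `q₁` ((B⇒) at `n' = n∪q₁`, then (A⇐) at `n`).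
[cite: WZhang2014, Thm. 4.3] [cite: BertoliniDarmon2005, Thm. 4.1, Thm. 4.2] -/
theorem transport_of_reciprocityLaws {M : Type} {κ₀ : M → Finset (AdmQ W K p) → Vp W K p}
    {lam : M → Finset (AdmQ W K p) → ZMod p}
    (lawA : ∀ (n : Finset (AdmQ W K p)) (q : AdmQ W K p), Even n.card → q ∉ n → ∀ m : M,
      lam m (insert q n) ≠ 0 → ∃ v : HeightOneSpectrum (𝓞 K), ((q : ℕ) : 𝓞 K) ∈ v.asIdeal ∧
        κ₀ m n ∉ (W.baseChange K).torsionLocalKer (v.adicCompletion K) ((p ^ 1 : ℕ) : ℤ))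
    (lawB : ∀ (n : Finset (AdmQ W K p)) (q : AdmQ W K p), Odd n.card → q ∉ n → ∀ (m : M)
      (v : HeightOneSpectrum (𝓞 K)), ((q : ℕ) : 𝓞 K) ∈ v.asIdeal →
      κ₀ m (insert q n) ∉ (W.baseChange K).torsionLocalKer (v.adicCompletion K) ((p ^ 1 : ℕ) : ℤ) → lam m n ≠ 0) :
    ∀ (n : Finset (AdmQ W K p)) (q₁ q₂ : AdmQ W K p), q₁ ∉ n → q₂ ∉ insert q₁ n → Even n.card →
      q₂ ∉ baseLocusQP W K p κ₀ (insert q₂ (insert q₁ n)) → ∃ m, κ₀ m n ≠ 0 := by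
  intro n q₁ q₂ hq₁ hq₂ he hbase
  obtain ⟨m, v, hv, hdet⟩ := (not_mem_baseLocusQP_iff W K p).mp hbase
  -- (B⇒) at the odd level `n ∪ q₁`: the value `λ(m, n∪q₁)` is non-zero
  have hlam : lam m (insert q₁ n) ≠ 0 := lawB (insert q₁ n) q₂ ((odd_card_insert_iff hq₁).mpr he) hq₂ m v hv hdet
  -- (A⇐) at the even level `n`: the class `κ₀(m, n)` is detected above `q₁`
  obtain ⟨v₁, -, hdet₁⟩ := lawA n q₁ he hq₁ m hlam
  exact ⟨m, ne_zero_of_not_mem_torsionLocalKer W K p hdet₁⟩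

end Summit.BirchSwinnertonDyer.BirchSwinnertonDyer.Theorems.AdditiveKoly

end
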